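import Mathlib
import HarnessLib

/-!
# The engine's POLAR chart of the `SU(3)` cell (v0.3, `cell='polar'`): box → wedge → alcove, with derivatives, determinants, injectivity and images

HONEST FRAMING: exact (Metropolis-corrected) sampling algorithms for lattice gauge theory;
figures of merit are autocorrelation/cost numbers at stated couplings and volumes; no
continuum-physics claim.

Venture `LatticeQCDFlow` (cell pub-lqcd), topic `Exactness`; FANOUT row 10 (`eng-equiv`, engine
`latflow.equiv` v0.3 `spectral.polar3_to_x` / `polar3_from_x`, `spectral_kernel(3, cell='polar')`:
"the POLAR chart of the triangle about a vertex" — Abbott et al., arXiv:2305.02402 §4.1.1, named only: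
`φ = u·π/3`, `R(φ) = π√2/cos(φ − π/6)` (distance from the vertex `y₃ = 0` to the opposite edge of the
equilateral cell of side `2π√(2/3)`), `r = v·R(φ)`, plane point `r(cos φ, sin φ)` in the orthonormal
basis `e_A = (−2,1,1)/√6`, `e_B = (0,−1,1)/√2` of the sum-zero plane; booked
`ld = log r + log R(φ) + log(π/3)`).  NEW WORK of the cell over Mathlib only; nothing is cited as a
fact; no number; no definition.  In FREE eigen-phase coordinates `(θ₀, θ₁)` (`θ₂ = −θ₀ − θ₁`, the
coordinates of `SU3TorusAlcoveJacobian` / `AlcoveAffineChartSU3`) and with the scaled radius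
`ρ = r/√6` the chart factors as `S = Q ∘ T`:

* `T(a) = (π/3·a₀, a₁·π/(√3·cos(π/3·a₀ − π/6)))` — box `B = (0,1)²` → wedge
  `W = {0 < φ < π/3, 0 < ρ < π/(√3 cos(φ − π/6))}`: `hasFDerivAt_boxToWedge_su3`,
  `det_boxToWedgeDeriv_su3` (triangular: `(π/3)·π/(√3 cos(…))`), `injOn_boxToWedge_su3`,
  `image_boxToWedge_su3`;
* `Q(φ, ρ) = (−2ρ cos φ, ρ cos φ − √3 ρ sin φ)` (`= r cos φ · e_A + r sin φ · e_B` read in free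
  coordinates) — wedge → alcove: `hasFDerivAt_wedgeToAlcove_su3`, `det_wedgeToAlcoveDeriv_su3` (`−2√3 ρ`),
  `injOn_wedgeToAlcove_su3`, **`image_wedgeToAlcove_su3`** — `Q(W)` IS the alcove
  `{θ₀ < θ₁ < −θ₀−θ₁ < θ₀ + 2π}` (the edge opposite the vertex is `ρ = π/(√3 cos(φ − π/6))` because
  `√3 cos φ + sin φ = 2 cos(φ − π/6)`).
The composite change of variables and the box-flow Jacobian are `PolarCellJacobianSU3.lean`.
-/

noncomputable section

namespace Summit.Ventures.LatticeQCDFlow.Exactness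

open MeasureTheory Set Real

/-! ## Elementary facts on the wedge angles -/

/-- For `0 < φ < π/3`: `cos φ > 0`, `sin φ > 0`, `cos(φ − π/6) > 0`. -/
theorem wedgeAngle_pos {φ : ℝ} (h0 : 0 < φ) (h1 : φ < π / 3) :
    0 < Real.cos φ ∧ 0 < Real.sin φ ∧ 0 < Real.cos (φ - π / 6) := by
  have hπ := Real.pi_pos
  refine ⟨Real.cos_pos_of_mem_Ioo ⟨by linarith, by linarith⟩, Real.sin_pos_of_pos_of_lt_pi h0 (by linarith),
    Real.cos_pos_of_mem_Ioo ⟨by linarith, by linarith⟩⟩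

/-- `√3 cos φ + sin φ = 2 cos(φ − π/6)`. -/
theorem sqrt3_mul_cos_add_sin (φ : ℝ) :
    Real.sqrt 3 * Real.cos φ + Real.sin φ = 2 * Real.cos (φ - π / 6) := by
  rw [Real.cos_sub, Real.cos_pi_div_six, Real.sin_pi_div_six]
  ring

/-- For `0 < φ < π/3`: `sin φ < √3 cos φ` (i.e. `tan φ < tan(π/3)`). -/
theorem sin_lt_sqrt3_mul_cos {φ : ℝ} (h0 : 0 < φ) (h1 : φ < π / 3) :
    Real.sin φ < Real.sqrt 3 * Real.cos φ := by
  have hπ := Real.pi_pos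
  have hs : 0 < Real.sin (π / 3 - φ) := Real.sin_pos_of_pos_of_lt_pi (by linarith) (by linarith)
  rw [Real.sin_sub, Real.sin_pi_div_three, Real.cos_pi_div_three] at hs
  linarith

/-! ## `T`: box → wedge -/

section BoxToWedge

/-- Derivative of `T(a) = (π/3·a₀, a₁·π/(√3 cos(π/3·a₀ − π/6)))` where the cosine is nonzero:
rows `(π/3, 0)` and `(a₁·E(a₀), π/(√3 cos ψ))`, `E = π·(√3 sin ψ·π/3)/(√3 cos ψ)²`, `ψ = π/3·a₀ − π/6`. -/
theorem hasFDerivAt_boxToWedge_su3 (a : Fin 2 → ℝ) (hc : Real.cos (π / 3 * a 0 - π / 6) ≠ 0) :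
    HasFDerivAt (fun a : Fin 2 → ℝ =>
        (![π / 3 * a 0, a 1 * (π / (Real.sqrt 3 * Real.cos (π / 3 * a 0 - π / 6)))] : Fin 2 → ℝ))
      (ContinuousLinearMap.pi ![(π / 3) • ContinuousLinearMap.proj (R := ℝ) (φ := fun _ : Fin 2 => ℝ) 0,
        a 1 • ((π * (Real.sqrt 3 * (Real.sin (π / 3 * a 0 - π / 6) * (π / 3))) /
            (Real.sqrt 3 * Real.cos (π / 3 * a 0 - π / 6)) ^ 2) •
            ContinuousLinearMap.proj (R := ℝ) (φ := fun _ : Fin 2 => ℝ) 0) +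
          (π / (Real.sqrt 3 * Real.cos (π / 3 * a 0 - π / 6))) •
            ContinuousLinearMap.proj (R := ℝ) (φ := fun _ : Fin 2 => ℝ) 1]) a := by
  rw [hasFDerivAt_pi']
  intro i
  rw [ContinuousLinearMap.proj_pi]
  have h0 : HasFDerivAt (fun a : Fin 2 → ℝ => a 0)
      (ContinuousLinearMap.proj (R := ℝ) (φ := fun _ : Fin 2 => ℝ) 0) a := hasFDerivAt_apply 0 a
  have h1 : HasFDerivAt (fun a : Fin 2 → ℝ => a 1)
      (ContinuousLinearMap.proj (R := ℝ) (φ := fun _ : Fin 2 => ℝ) 1) a := hasFDerivAt_apply 1 a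
  fin_cases i
  · simp only [Fin.zero_eta, Matrix.cons_val_zero]
    exact h0.const_mul _
  · simp only [Fin.mk_one, Matrix.cons_val_one, Matrix.cons_val_zero]
    have hden0 : Real.sqrt 3 * Real.cos (π / 3 * a 0 - π / 6) ≠ 0 :=
      mul_ne_zero (Real.sqrt_ne_zero'.mpr (by norm_num)) hc
    -- one real variable: `t ↦ π/(√3 cos(π/3·t − π/6))`
    have hin : HasDerivAt (fun t : ℝ => π / 3 * t - π / 6) (π / 3) (a 0) := by
      simpa using ((hasDerivAt_id (a 0)).const_mul (π / 3)).sub_const (π / 6)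
    have hd : HasDerivAt (fun t : ℝ => Real.sqrt 3 * Real.cos (π / 3 * t - π / 6))
        (Real.sqrt 3 * (-Real.sin (π / 3 * a 0 - π / 6) * (π / 3))) (a 0) :=
      ((Real.hasDerivAt_cos _).comp (a 0) hin).const_mul _
    have hg : HasDerivAt (fun t : ℝ => π / (Real.sqrt 3 * Real.cos (π / 3 * t - π / 6)))
        (π * (Real.sqrt 3 * (Real.sin (π / 3 * a 0 - π / 6) * (π / 3))) /
          (Real.sqrt 3 * Real.cos (π / 3 * a 0 - π / 6)) ^ 2) (a 0) := by
      have h := (hasDerivAt_const (a 0) π).div hd hden0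
      refine h.congr_deriv ?_
      ring
    have hG := HasDerivAt.comp_hasFDerivAt
      (h₂ := fun t : ℝ => π / (Real.sqrt 3 * Real.cos (π / 3 * t - π / 6)))
      (f := fun a : Fin 2 → ℝ => a 0) a hg h0
    exact h1.mul hG

/-- `det dT(a) = (π/3)·π/(√3 cos ψ)` (lower triangular). -/
theorem det_boxToWedgeDeriv_su3 (a : Fin 2 → ℝ) :
    (ContinuousLinearMap.pi ![(π / 3) • ContinuousLinearMap.proj (R := ℝ) (φ := fun _ : Fin 2 => ℝ) 0,
        a 1 • ((π * (Real.sqrt 3 * (Real.sin (π / 3 * a 0 - π / 6) * (π / 3))) /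
            (Real.sqrt 3 * Real.cos (π / 3 * a 0 - π / 6)) ^ 2) •
            ContinuousLinearMap.proj (R := ℝ) (φ := fun _ : Fin 2 => ℝ) 0) +
          (π / (Real.sqrt 3 * Real.cos (π / 3 * a 0 - π / 6))) •
            ContinuousLinearMap.proj (R := ℝ) (φ := fun _ : Fin 2 => ℝ) 1]).det =
      π / 3 * (π / (Real.sqrt 3 * Real.cos (π / 3 * a 0 - π / 6))) := by
  rw [ContinuousLinearMap.det, ← LinearMap.det_toMatrix', Matrix.det_fin_two]
  simp [LinearMap.toMatrix'_apply]

/-- `T` is injective on the box (indeed wherever the cosine is nonzero on both points' angles). -/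
theorem injOn_boxToWedge_su3 :
    InjOn (fun a : Fin 2 → ℝ =>
        (![π / 3 * a 0, a 1 * (π / (Real.sqrt 3 * Real.cos (π / 3 * a 0 - π / 6)))] : Fin 2 → ℝ))
      (Set.pi univ fun _ : Fin 2 => Ioo (0 : ℝ) 1) := by
  intro a ha b hb hab
  have hπ := Real.pi_pos
  have ha0 := ha 0 (mem_univ _)
  have e0 : π / 3 * a 0 = π / 3 * b 0 := by simpa using congr_fun hab 0
  have h0 : a 0 = b 0 := mul_left_cancel₀ (by positivity) e0
  have e1 : a 1 * (π / (Real.sqrt 3 * Real.cos (π / 3 * a 0 - π / 6))) =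
      b 1 * (π / (Real.sqrt 3 * Real.cos (π / 3 * b 0 - π / 6))) := by simpa using congr_fun hab 1
  rw [h0] at e1
  have hc : 0 < Real.cos (π / 3 * b 0 - π / 6) := by
    have hb0 := hb 0 (mem_univ _)
    exact (wedgeAngle_pos (φ := π / 3 * b 0) (by nlinarith [hb0.1]) (by nlinarith [hb0.2])).2.2
  have hg : π / (Real.sqrt 3 * Real.cos (π / 3 * b 0 - π / 6)) ≠ 0 := by positivity
  have h1 : a 1 = b 1 := mul_right_cancel₀ hg e1
  funext i
  fin_cases i
  · exact h0
  · exact h1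

/-- **The image of the box is the wedge** `{0 < φ < π/3, 0 < ρ < π/(√3 cos(φ − π/6))}`. -/
theorem image_boxToWedge_su3 :
    (fun a : Fin 2 → ℝ =>
        (![π / 3 * a 0, a 1 * (π / (Real.sqrt 3 * Real.cos (π / 3 * a 0 - π / 6)))] : Fin 2 → ℝ)) ''
        (Set.pi univ fun _ : Fin 2 => Ioo (0 : ℝ) 1) =
      {z : Fin 2 → ℝ | 0 < z 0 ∧ z 0 < π / 3 ∧ 0 < z 1 ∧ z 1 < π / (Real.sqrt 3 * Real.cos (z 0 - π / 6))} := by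
  have hπ := Real.pi_pos
  have h3 : (0 : ℝ) < Real.sqrt 3 := Real.sqrt_pos.mpr (by norm_num)
  ext z
  simp only [mem_image, mem_setOf_eq]
  constructor
  · rintro ⟨a, ha, rfl⟩
    have ha0 := ha 0 (mem_univ _)
    have ha1 := ha 1 (mem_univ _)
    simp only [Matrix.cons_val_zero, Matrix.cons_val_one]
    have hφ0 : 0 < π / 3 * a 0 := by nlinarith [ha0.1]
    have hφ1 : π / 3 * a 0 < π / 3 := by nlinarith [ha0.2]
    have hc := (wedgeAngle_pos hφ0 hφ1).2.2
    have hg : 0 < π / (Real.sqrt 3 * Real.cos (π / 3 * a 0 - π / 6)) := by positivity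
    refine ⟨hφ0, hφ1, mul_pos ha1.1 hg, ?_⟩
    calc a 1 * (π / (Real.sqrt 3 * Real.cos (π / 3 * a 0 - π / 6)))
        < 1 * (π / (Real.sqrt 3 * Real.cos (π / 3 * a 0 - π / 6))) := mul_lt_mul_of_pos_right ha1.2 hg
      _ = _ := one_mul _
  · rintro ⟨h0, h1, h2, h4⟩
    have hc := (wedgeAngle_pos h0 h1).2.2
    have hg : 0 < π / (Real.sqrt 3 * Real.cos (z 0 - π / 6)) := by positivity
    refine ⟨![z 0 / (π / 3), z 1 / (π / (Real.sqrt 3 * Real.cos (z 0 - π / 6)))], fun i _ => ?_, ?_⟩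
    · fin_cases i
      · simp only [Fin.zero_eta, Matrix.cons_val_zero]
        exact ⟨div_pos h0 (by positivity), (div_lt_one (by positivity)).mpr h1⟩
      · simp only [Fin.mk_one, Matrix.cons_val_one, Matrix.cons_val_zero]
        exact ⟨div_pos h2 hg, (div_lt_one hg).mpr h4⟩
    · have e0 : π / 3 * (z 0 / (π / 3)) = z 0 := by field_simp
      funext i
      fin_cases i
      · simp only [Fin.zero_eta, Matrix.cons_val_zero]
        exact e0
      · simp only [Fin.mk_one, Matrix.cons_val_one, Matrix.cons_val_zero]
        rw [e0]
        exact div_mul_cancel₀ _ hg.ne'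

end BoxToWedge


/-! ## `Q`: wedge → alcove (polar coordinates read in free eigen-phases) -/

section WedgeToAlcove

/-- Derivative of `Q(φ, ρ) = (−2ρ cos φ, ρ cos φ − √3 ρ sin φ)`. -/
theorem hasFDerivAt_wedgeToAlcove_su3 (z : Fin 2 → ℝ) :
    HasFDerivAt (fun z : Fin 2 → ℝ =>
        (![-2 * z 1 * Real.cos (z 0), z 1 * Real.cos (z 0) - Real.sqrt 3 * z 1 * Real.sin (z 0)] : Fin 2 → ℝ))
      (ContinuousLinearMap.pi ![
        (-2 * z 1) • ((-Real.sin (z 0)) • ContinuousLinearMap.proj (R := ℝ) (φ := fun _ : Fin 2 => ℝ) 0) +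
          Real.cos (z 0) • ((-2 : ℝ) • ContinuousLinearMap.proj (R := ℝ) (φ := fun _ : Fin 2 => ℝ) 1),
        (z 1 • ((-Real.sin (z 0)) • ContinuousLinearMap.proj (R := ℝ) (φ := fun _ : Fin 2 => ℝ) 0) +
            Real.cos (z 0) • ContinuousLinearMap.proj (R := ℝ) (φ := fun _ : Fin 2 => ℝ) 1) -
          ((Real.sqrt 3 * z 1) • (Real.cos (z 0) • ContinuousLinearMap.proj (R := ℝ) (φ := fun _ : Fin 2 => ℝ) 0) +
            Real.sin (z 0) • (Real.sqrt 3 • ContinuousLinearMap.proj (R := ℝ) (φ := fun _ : Fin 2 => ℝ) 1))]) z := by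
  rw [hasFDerivAt_pi']
  intro i
  rw [ContinuousLinearMap.proj_pi]
  have h0 : HasFDerivAt (fun a : Fin 2 → ℝ => a 0)
      (ContinuousLinearMap.proj (R := ℝ) (φ := fun _ : Fin 2 => ℝ) 0) z := hasFDerivAt_apply 0 z
  have h1 : HasFDerivAt (fun a : Fin 2 → ℝ => a 1)
      (ContinuousLinearMap.proj (R := ℝ) (φ := fun _ : Fin 2 => ℝ) 1) z := hasFDerivAt_apply 1 z
  have hcos := HasDerivAt.comp_hasFDerivAt (h₂ := Real.cos) (f := fun a : Fin 2 → ℝ => a 0) z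
    (Real.hasDerivAt_cos (z 0)) h0
  have hsin := HasDerivAt.comp_hasFDerivAt (h₂ := Real.sin) (f := fun a : Fin 2 → ℝ => a 0) z
    (Real.hasDerivAt_sin (z 0)) h0
  fin_cases i
  · simp only [Fin.zero_eta, Matrix.cons_val_zero]
    exact (h1.const_mul (-2)).mul hcos
  · simp only [Fin.mk_one, Matrix.cons_val_one, Matrix.cons_val_zero]
    exact (h1.mul hcos).sub ((h1.const_mul (Real.sqrt 3)).mul hsin)

/-- `det dQ(φ, ρ) = −2√3 ρ`. -/
theorem det_wedgeToAlcoveDeriv_su3 (z : Fin 2 → ℝ) :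
    (ContinuousLinearMap.pi ![
        (-2 * z 1) • ((-Real.sin (z 0)) • ContinuousLinearMap.proj (R := ℝ) (φ := fun _ : Fin 2 => ℝ) 0) +
          Real.cos (z 0) • ((-2 : ℝ) • ContinuousLinearMap.proj (R := ℝ) (φ := fun _ : Fin 2 => ℝ) 1),
        (z 1 • ((-Real.sin (z 0)) • ContinuousLinearMap.proj (R := ℝ) (φ := fun _ : Fin 2 => ℝ) 0) +
            Real.cos (z 0) • ContinuousLinearMap.proj (R := ℝ) (φ := fun _ : Fin 2 => ℝ) 1) -
          ((Real.sqrt 3 * z 1) • (Real.cos (z 0) • ContinuousLinearMap.proj (R := ℝ) (φ := fun _ : Fin 2 => ℝ) 0) +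
            Real.sin (z 0) • (Real.sqrt 3 • ContinuousLinearMap.proj (R := ℝ) (φ := fun _ : Fin 2 => ℝ) 1))]).det =
      -2 * Real.sqrt 3 * z 1 := by
  rw [ContinuousLinearMap.det, ← LinearMap.det_toMatrix', Matrix.det_fin_two]
  simp [LinearMap.toMatrix'_apply]
  have h := Real.sin_sq_add_cos_sq (z 0)
  linear_combination (-2 * Real.sqrt 3 * z 1) * h

/-- `Q` is injective on `{0 < φ < π/3, 0 < ρ}` (polar coordinates: the radius is `√(p² + q²)`, the
angle is recovered from its cosine on `[0, π]`). -/
theorem injOn_wedgeToAlcove_su3 :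
    InjOn (fun z : Fin 2 → ℝ =>
        (![-2 * z 1 * Real.cos (z 0), z 1 * Real.cos (z 0) - Real.sqrt 3 * z 1 * Real.sin (z 0)] : Fin 2 → ℝ))
      {z : Fin 2 → ℝ | 0 < z 0 ∧ z 0 < π / 3 ∧ 0 < z 1} := by
  intro a ha b hb hab
  obtain ⟨ha0, ha1, ha2⟩ := ha
  obtain ⟨hb0, hb1, hb2⟩ := hb
  have hπ := Real.pi_pos
  have h3 : (0 : ℝ) < Real.sqrt 3 := Real.sqrt_pos.mpr (by norm_num)
  have e0 : -2 * a 1 * Real.cos (a 0) = -2 * b 1 * Real.cos (b 0) := by simpa using congr_fun hab 0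
  have e1 : a 1 * Real.cos (a 0) - Real.sqrt 3 * a 1 * Real.sin (a 0) =
      b 1 * Real.cos (b 0) - Real.sqrt 3 * b 1 * Real.sin (b 0) := by simpa using congr_fun hab 1
  have hc : a 1 * Real.cos (a 0) = b 1 * Real.cos (b 0) := by linarith
  have hs : a 1 * Real.sin (a 0) = b 1 * Real.sin (b 0) := by
    have : Real.sqrt 3 * (a 1 * Real.sin (a 0)) = Real.sqrt 3 * (b 1 * Real.sin (b 0)) := by linarith
    exact mul_left_cancel₀ h3.ne' this
  have hsq : a 1 ^ 2 = b 1 ^ 2 := by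
    have ha' := Real.sin_sq_add_cos_sq (a 0)
    have hb' := Real.sin_sq_add_cos_sq (b 0)
    calc a 1 ^ 2 = a 1 ^ 2 * (Real.sin (a 0) ^ 2 + Real.cos (a 0) ^ 2) := by rw [ha', mul_one]
      _ = (a 1 * Real.sin (a 0)) ^ 2 + (a 1 * Real.cos (a 0)) ^ 2 := by ring
      _ = (b 1 * Real.sin (b 0)) ^ 2 + (b 1 * Real.cos (b 0)) ^ 2 := by rw [hs, hc]
      _ = b 1 ^ 2 * (Real.sin (b 0) ^ 2 + Real.cos (b 0) ^ 2) := by ring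
      _ = b 1 ^ 2 := by rw [hb', mul_one]
  have h1 : a 1 = b 1 := by
    have := (sq_eq_sq₀ ha2.le hb2.le).mp hsq
    exact this
  have hcos : Real.cos (a 0) = Real.cos (b 0) := by
    rw [h1] at hc
    exact mul_left_cancel₀ hb2.ne' hc
  have h0 : a 0 = b 0 :=
    Real.injOn_cos ⟨ha0.le, by linarith⟩ ⟨hb0.le, by linarith⟩ hcos
  funext i
  fin_cases i
  · exact h0
  · exact h1

/-- **The image of the wedge is the alcove**:
`Q '' {0 < φ < π/3, 0 < ρ < π/(√3 cos(φ − π/6))} = {θ₀ < θ₁ < −θ₀−θ₁ < θ₀ + 2π}`. -/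
theorem image_wedgeToAlcove_su3 :
    (fun z : Fin 2 → ℝ =>
        (![-2 * z 1 * Real.cos (z 0), z 1 * Real.cos (z 0) - Real.sqrt 3 * z 1 * Real.sin (z 0)] : Fin 2 → ℝ)) ''
        {z : Fin 2 → ℝ | 0 < z 0 ∧ z 0 < π / 3 ∧ 0 < z 1 ∧ z 1 < π / (Real.sqrt 3 * Real.cos (z 0 - π / 6))} =
      {θ : Fin 2 → ℝ | θ 0 < θ 1 ∧ θ 1 < -(θ 0 + θ 1) ∧ -(θ 0 + θ 1) < θ 0 + 2 * π} := by
  have hπ := Real.pi_pos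
  have h3 : (0 : ℝ) < Real.sqrt 3 := Real.sqrt_pos.mpr (by norm_num)
  have h33 : Real.sqrt 3 * Real.sqrt 3 = 3 := Real.mul_self_sqrt (by norm_num)
  ext θ
  simp only [mem_image, mem_setOf_eq]
  constructor
  · rintro ⟨z, ⟨h0, h1, h2, h4⟩, rfl⟩
    simp only [Matrix.cons_val_zero, Matrix.cons_val_one]
    obtain ⟨hc, hs, hcψ⟩ := wedgeAngle_pos h0 h1
    have hlt := sin_lt_sqrt3_mul_cos h0 h1
    have hid := sqrt3_mul_cos_add_sin (z 0)
    have h4' : z 1 * (Real.sqrt 3 * Real.cos (z 0 - π / 6)) < π := by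
      rwa [lt_div_iff₀ (by positivity)] at h4
    have h33' : Real.sqrt 3 ^ 2 = 3 := Real.sq_sqrt (by norm_num)
    refine ⟨?_, ?_, ?_⟩
    · -- `θ₀ < θ₁` ⟺ `√3 ρ sin φ < 3 ρ cos φ`
      have hm : 0 < Real.sqrt 3 * z 1 * (Real.sqrt 3 * Real.cos (z 0) - Real.sin (z 0)) :=
        mul_pos (mul_pos h3 h2) (sub_pos.mpr hlt)
      have e : Real.sqrt 3 * z 1 * (Real.sqrt 3 * Real.cos (z 0) - Real.sin (z 0)) =
          3 * z 1 * Real.cos (z 0) - Real.sqrt 3 * z 1 * Real.sin (z 0) := by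
        linear_combination (z 1 * Real.cos (z 0)) * h33'
      linarith [hm, e]
    · nlinarith [mul_pos (mul_pos h3 h2) hs]
    · -- `θ₂ < θ₀ + 2π` ⟺ `3ρ cos φ + √3 ρ sin φ < 2π` ⟺ `ρ √3 cos(φ − π/6) < π`
      have e : z 1 * (Real.sqrt 3 * Real.cos (z 0 - π / 6)) =
          (3 * z 1 * Real.cos (z 0) + Real.sqrt 3 * z 1 * Real.sin (z 0)) / 2 := by
        have e2 : Real.cos (z 0 - π / 6) = (Real.sqrt 3 * Real.cos (z 0) + Real.sin (z 0)) / 2 := by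
          linarith [hid]
        rw [e2]
        linear_combination (z 1 * Real.cos (z 0) / 2) * h33'
      linarith [h4', e]
  · rintro ⟨h01, h12, h20⟩
    -- recover `(φ, ρ)` from `P = ρ cos φ = −θ₀/2 > 0` and `Qv = ρ sin φ = (−θ₀/2 − θ₁)/√3 > 0`
    have hP : 0 < -θ 0 / 2 := by linarith
    have hQ : 0 < (-θ 0 / 2 - θ 1) / Real.sqrt 3 := div_pos (by linarith) h3
    set P : ℝ := -θ 0 / 2 with hPdef
    set Qv : ℝ := (-θ 0 / 2 - θ 1) / Real.sqrt 3 with hQdef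
    set t : ℝ := Qv / P with htdef
    have ht : 0 < t := div_pos hQ hP
    have hsq : 0 < Real.sqrt (1 + t ^ 2) := Real.sqrt_pos.mpr (by positivity)
    have hcosφ : Real.cos (Real.arctan t) = 1 / Real.sqrt (1 + t ^ 2) := Real.cos_arctan t
    have hsinφ : Real.sin (Real.arctan t) = t / Real.sqrt (1 + t ^ 2) := Real.sin_arctan t
    have hρcos : P * Real.sqrt (1 + t ^ 2) * Real.cos (Real.arctan t) = P := by
      rw [hcosφ]; field_simp
    have hρsin : P * Real.sqrt (1 + t ^ 2) * Real.sin (Real.arctan t) = Qv := by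
      rw [hsinφ, htdef]; field_simp
    have hsqrt3Q : Real.sqrt 3 * Qv = -θ 0 / 2 - θ 1 := by
      rw [hQdef]; field_simp
    have hφ0 : 0 < Real.arctan t := Real.arctan_pos.mpr ht
    have hφ1 : Real.arctan t < π / 3 := by
      have htlt : t < Real.sqrt 3 := by
        rw [htdef, div_lt_iff₀ hP]
        have : Qv * Real.sqrt 3 < Real.sqrt 3 * P * Real.sqrt 3 := by nlinarith [hsqrt3Q, h33, hP]
        nlinarith [this, h3]
      have := Real.arctan_lt_arctan_iff.mpr htlt
      rwa [← Real.tan_pi_div_three, Real.arctan_tan (by linarith) (by linarith)] at this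
    refine ⟨![Real.arctan t, P * Real.sqrt (1 + t ^ 2)], ⟨?_, ?_, ?_, ?_⟩, ?_⟩
    · simpa using hφ0
    · simpa using hφ1
    · simp only [Matrix.cons_val_one, Matrix.cons_val_zero]; positivity
    · simp only [Matrix.cons_val_one, Matrix.cons_val_zero]
      have hcψ := (wedgeAngle_pos hφ0 hφ1).2.2
      rw [lt_div_iff₀ (by positivity)]
      have hid := sqrt3_mul_cos_add_sin (Real.arctan t)
      -- ρ·√3·cos(φ − π/6) = (√3/2)(√3 P + Qv) = (3P + √3 Qv)/2 = (−2θ₀ − θ₁)/2 < π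
      have e : P * Real.sqrt (1 + t ^ 2) * (Real.sqrt 3 * Real.cos (Real.arctan t - π / 6)) =
          (3 * P + Real.sqrt 3 * Qv) / 2 := by
        have e2 : Real.cos (Real.arctan t - π / 6) =
            (Real.sqrt 3 * Real.cos (Real.arctan t) + Real.sin (Real.arctan t)) / 2 := by linarith [hid]
        rw [e2]
        have := hρcos
        have := hρsin
        nlinarith [hρcos, hρsin, h33]
      rw [e, hsqrt3Q, hPdef]
      linarith
    · funext i
      fin_cases i
      · simp only [Fin.zero_eta, Matrix.cons_val_zero, Matrix.cons_val_one]
        rw [show -2 * (P * Real.sqrt (1 + t ^ 2)) * Real.cos (Real.arctan t) =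
          -2 * (P * Real.sqrt (1 + t ^ 2) * Real.cos (Real.arctan t)) by ring, hρcos, hPdef]
        ring
      · simp only [Fin.mk_one, Matrix.cons_val_one, Matrix.cons_val_zero]
        rw [show Real.sqrt 3 * (P * Real.sqrt (1 + t ^ 2)) * Real.sin (Real.arctan t) =
          Real.sqrt 3 * (P * Real.sqrt (1 + t ^ 2) * Real.sin (Real.arctan t)) by ring, hρsin, hρcos, hsqrt3Q, hPdef]
        ring

end WedgeToAlcove

end Summit.Ventures.LatticeQCDFlow.Exactness
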